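import Literature.MathematicalPhysics.QuantumFieldTheory.ConformalBootstrap3D.PointKernelK34L505Data
import Literature.MathematicalPhysics.QuantumFieldTheory.ConformalBootstrap3D.PointKernelK34L505Segs
import Literature.MathematicalPhysics.QuantumFieldTheory.ConformalBootstrap3D.PointKernelParts

/-!
# K34L505 certificate, kernel part file P41: one-cell head segments 104, 105 in level ranges

The head cells whose kernel evaluation exceeds one `decide` are one-cell segments of `hsegsK34L505`; each is
checked by `PCert.hPartSideOK` (side conditions) and `PCert.hPartOK` per level range `[n_lo, n_lo + count)`
against an integer claim, the claims summing to `≥ 0` (`PointKernel.partsOK`); soundness is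
`PCert.hParts_sound` (`PointKernelParts`).  The part files are mutually independent (each imports only
the data file); the ranges of one cell may span several of them, and the per-cell conclusions
`hparts_i` / `hcell_i` of those cells are assembled in `PointKernelK34L505.lean`.
Estimated kernel time 242 s.
-/

set_option maxRecDepth 100000
set_option maxHeartbeats 0

namespace Literature.MathematicalPhysics.QuantumFieldTheory.ConformalBootstrap3D.PointKernelK34L505

open Literature.MathematicalPhysics.QuantumFieldTheory.ConformalBootstrap3D.PointKernel

/-- levels `[49, 56)` of segment 104: partial lower sum `≥` claim. [folklore] -/
theorem part_104_3 : certK34L505.hPartOK (PCert.segAt hsegsK34L505 104) JHK34L505 49 7 (1345110317264213534101812033766272625) = true := by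
  decide +kernel

/-- levels `[56, 61)` of segment 104: partial lower sum `≥` claim. [folklore] -/
theorem part_104_4 : certK34L505.hPartOK (PCert.segAt hsegsK34L505 104) JHK34L505 56 5 (478488601946860363348440409990550081) = true := by
  decide +kernel

/-- levels `[61, 65)` of segment 104: partial lower sum `≥` claim. [folklore] -/
theorem part_104_5 : certK34L505.hPartOK (PCert.segAt hsegsK34L505 104) JHK34L505 61 4 (223014969779334864710016727596697869) = true := by
  decide +kernel

/-- one-cell segment 105 (row 6, cell `[7173/1024, 3587/512]`, chord, `n_F = 64`,
6 level ranges): side conditions. [folklore] -/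
theorem pside_105 : certK34L505.hPartSideOK (PCert.segAt hsegsK34L505 105) JHK34L505 = true := by
  decide +kernel

/-- its level ranges `(n_lo, count, claim)`. [folklore] -/
def partsK34L505_105 : List (ℕ × ℕ × ℤ) := [(0, 28, -21483722991026238674895065909241666109), (28, 12, 15450698654268850315127166871887397086), (40, 9, 4145300362556156658958330578211157818), (49, 7, 1292564627019465969550617729105404330), (56, 5, 425397870485761624566427687241870364), (61, 4, 169761476696004106692523042795836512)]

/-- the ranges tile `[0, n_F]` and the claims sum to `≥ 0`. [folklore] -/
theorem pcov_105 : PointKernel.partsOK 64 partsK34L505_105 = true := by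
  decide +kernel

/-- levels `[0, 28)` of segment 105: partial lower sum `≥` claim. [folklore] -/
theorem part_105_0 : certK34L505.hPartOK (PCert.segAt hsegsK34L505 105) JHK34L505 0 28 (-21483722991026238674895065909241666109) = true := by
  decide +kernel

end Literature.MathematicalPhysics.QuantumFieldTheory.ConformalBootstrap3D.PointKernelK34L505
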